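import Mathlib

/-!
# SoloInformedTwinCRTCount — residue-class counts on `[1, x]` and the CRT classes of the twin divisor pairs

Solo unit `solo-Parity-informed` (ideation tier, informed mode), session 40; `paper.md` §20 (proof of
Theorems 20.1/20.2, step (2): "exact count + CRT fraction"), `PLAN.md` §41.2 / §44, CLAIMS C117.
Companion file `SoloInformedTwinPairSum` re-indexes the located twin sum of
`twinPrime_isEquivalent_iff_tail_isLittleO` (`SoloInformedTwinPrimeLocalisation`, C89),
`∑_{n ≤ x} ∑_{e ∣ n(n+2), e > y} μ(e) log² e`, over divisor pairs `(e₁, e₂)`; this file supplies the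
arithmetic of one pair, sorry-free and with no analytic input:

* the count: for `q ≥ 1` and any class `c ∈ ℤ`, with `ρ ∈ (0, q]` a representative
  (`exists_rep_Ioc`): `#{1 ≤ n ≤ x : n ≡ c (mod q)} = ⌊(x − ρ)/q⌋ + 1` exactly
  (`card_Icc_filter_modEq_eq_floor`, from Mathlib's `Nat.Ioc_filter_modEq_card`),
  `= x/q − (ρ/q − 1/2) − ψ((x−ρ)/q)` with `ψ(t) = {t} − 1/2` (`card_Icc_filter_modEq_eq_sawtooth`),
  hence `|# − x/q| ≤ 1` (`abs_card_Icc_filter_modEq_sub_le`).  The representative lives in `(0, q]`,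
  not `[0, q)` — the two differ exactly when `q ∣ c`, e.g. `e₂ = 1` below (`PLAN.md` §41, C113);
* the classes (Chinese remainder theorem): for `e₁, e₂` odd coprime and `e₁ē ≡ 1 (mod e₂)`,
  `n odd ∧ e₁ ∣ n ∧ e₂ ∣ n+2 ⟺ n ≡ e₁e₂ − 2e₁ē (mod 2e₁e₂)` — the class whose fraction is the
  Kloosterman fraction `1/2 − ē/e₂` — and, for `e₁, e₂` coprime,
  `e₁ ∣ m ∧ e₂ ∣ m+1 ⟺ m ≡ −e₁ē (mod e₁e₂)` (fraction `−ē/e₂`)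
  (`odd_and_dvd_and_dvd_add_two_iff`, `dvd_and_dvd_add_one_iff`, `exists_inverse_mod`,
  `rep_div_eq_half_sub_of_modEq`, `rep_div_eq_neg_div_of_modEq`); only (odd) coprime pairs occur
  (`odd_odd_coprime_of_dvd`, `coprime_of_dvd_of_dvd_add_one`);
* step (2) of paper.md §20 for both parities (`odd_twin_count_sawtooth`,
  `even_twin_count_sawtooth`): `#{n ≤ x odd : e₁ ∣ n, e₂ ∣ n+2}` resp. `#{m ≤ X : e₁ ∣ m, e₂ ∣ m+1}`
  equals `x'/Q − (ρ/Q − 1/2) − ψ((x' − ρ)/Q)` with `Q = 2e₁e₂` resp. `e₁e₂` and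
  `ρ/Q ≡ 1/2 − ē/e₂` resp. `−ē/e₂ (mod 1)`.

Deliberately NOT here: any estimate (Bombieri–Vinogradov for `μ`, Kloosterman-sum bounds, Vaaler's
lemma — paper.md §20; none is in the tree).
-/

namespace Summit.Parity.BatemanHorn.Theorems

open Finset

/-! ### 1. Counting a residue class on `[1, x]` exactly -/

/-- Every residue class modulo `q ≥ 1` has a representative in `(0, q]`. -/
theorem exists_rep_Ioc {q : ℕ} (hq : 0 < q) (c : ℤ) :
    ∃ ρ : ℕ, 0 < ρ ∧ ρ ≤ q ∧ (ρ : ℤ) ≡ c [ZMOD q] := by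
  have hq' : (0 : ℤ) < q := by exact_mod_cast hq
  have h0 : 0 ≤ (c - 1) % q := Int.emod_nonneg (c - 1) hq'.ne'
  have h1 : (c - 1) % q < q := Int.emod_lt_of_pos (c - 1) hq'
  refine ⟨((c - 1) % q).toNat + 1, Nat.succ_pos _, ?_, ?_⟩
  · have : (((c - 1) % q).toNat : ℤ) = (c - 1) % q := Int.toNat_of_nonneg h0
    omega
  · have : (((c - 1) % q).toNat : ℤ) = (c - 1) % q := Int.toNat_of_nonneg h0
    push_cast
    rw [this]
    calc (c - 1) % q + 1 ≡ (c - 1) + 1 [ZMOD q] := (Int.mod_modEq _ _).add_right 1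
      _ = c := by ring

/-- Exact count of a residue class on `[1, x]`, representative `ρ ∈ (0, q]`:
`#{1 ≤ n ≤ x : n ≡ ρ (mod q)} = ⌊(x − ρ)/q⌋ + 1` (Mathlib's `Nat.Ioc_filter_modEq_card`). -/
theorem card_Icc_filter_natModEq_eq_floor {q ρ : ℕ} (hq : 0 < q) (hρ : 0 < ρ) (hρq : ρ ≤ q)
    (x : ℕ) :
    ((#{n ∈ Icc 1 x | n ≡ ρ [MOD q]} : ℕ) : ℤ) = ⌊((x : ℚ) - ρ) / q⌋ + 1 := by
  have h := Nat.Ioc_filter_modEq_card 0 x hq ρ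
  have hq' : (0 : ℚ) < q := by exact_mod_cast hq
  have hfl : ⌊((0 : ℕ) - ρ : ℚ) / q⌋ = -1 := by
    rw [Int.floor_eq_iff, Nat.cast_zero, zero_sub]
    constructor
    · rw [Int.cast_neg, Int.cast_one, le_div_iff₀ hq', neg_one_mul, neg_le_neg_iff]
      exact_mod_cast hρq
    · rw [Int.cast_neg, Int.cast_one, div_lt_iff₀ hq']
      have : (0 : ℚ) < ρ := by exact_mod_cast hρ
      linarith
  have hmono : (-1 : ℤ) ≤ ⌊((x : ℚ) - ρ) / q⌋ := by
    rw [← hfl, Nat.cast_zero]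
    exact Int.floor_le_floor (div_le_div_of_nonneg_right (by simp) hq'.le)
  rw [← Finset.Icc_add_one_left_eq_Ioc, zero_add, hfl, sub_neg_eq_add, max_eq_left (by omega)] at h
  exact h

/-- The same count for an integer class `c`, through any representative `ρ ∈ (0, q]` of `c`:
`#{1 ≤ n ≤ x : n ≡ c (mod q)} = ⌊(x − ρ)/q⌋ + 1`. -/
theorem card_Icc_filter_modEq_eq_floor {q ρ : ℕ} {c : ℤ} (hq : 0 < q) (hρ : 0 < ρ) (hρq : ρ ≤ q)
    (hρc : (ρ : ℤ) ≡ c [ZMOD q]) (x : ℕ) :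
    ((#{n ∈ Icc 1 x | ((n : ℕ) : ℤ) ≡ c [ZMOD q]} : ℕ) : ℤ) = ⌊((x : ℚ) - ρ) / q⌋ + 1 := by
  rw [← card_Icc_filter_natModEq_eq_floor hq hρ hρq x]
  congr 2
  refine filter_congr fun n _ => ?_
  rw [← Int.natCast_modEq_iff]
  exact ⟨fun h => h.trans hρc.symm, fun h => h.trans hρc⟩

/-- Sawtooth form of the count: with `ψ(t) = {t} − 1/2`,
`#{1 ≤ n ≤ x : n ≡ c (mod q)} = x/q − (ρ/q − 1/2) − ψ((x − ρ)/q)`. -/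
theorem card_Icc_filter_modEq_eq_sawtooth {q ρ : ℕ} {c : ℤ} (hq : 0 < q) (hρ : 0 < ρ)
    (hρq : ρ ≤ q) (hρc : (ρ : ℤ) ≡ c [ZMOD q]) (x : ℕ) :
    ((#{n ∈ Icc 1 x | ((n : ℕ) : ℤ) ≡ c [ZMOD q]} : ℕ) : ℝ)
      = x / q - ((ρ : ℝ) / q - 1 / 2) - (Int.fract (((x : ℝ) - ρ) / q) - 1 / 2) := by
  have h := congrArg (fun z : ℤ => (z : ℝ)) (card_Icc_filter_modEq_eq_floor hq hρ hρq hρc x)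
  simp only [Int.cast_natCast, Int.cast_add, Int.cast_one] at h
  have hfl : ((⌊((x : ℚ) - ρ) / q⌋ : ℤ) : ℝ) = ⌊((x : ℝ) - ρ) / q⌋ := by
    rw [← Rat.floor_cast (α := ℝ)]
    push_cast
    rfl
  rw [h, hfl, ← Int.self_sub_fract]
  ring

/-- Hence `|#{1 ≤ n ≤ x : n ≡ c (mod q)} − x/q| ≤ 1`. -/
theorem abs_card_Icc_filter_modEq_sub_le {q : ℕ} (hq : 0 < q) (c : ℤ) (x : ℕ) :
    |((#{n ∈ Icc 1 x | ((n : ℕ) : ℤ) ≡ c [ZMOD q]} : ℕ) : ℝ) - x / q| ≤ 1 := by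
  obtain ⟨ρ, hρ, hρq, hρc⟩ := exists_rep_Ioc hq c
  rw [card_Icc_filter_modEq_eq_sawtooth hq hρ hρq hρc x]
  have h0 := Int.fract_nonneg (((x : ℝ) - ρ) / q)
  have h1 := Int.fract_lt_one (((x : ℝ) - ρ) / q)
  have hq' : (0 : ℝ) < q := by exact_mod_cast hq
  have hr0 : (0 : ℝ) < ρ / q := div_pos (by exact_mod_cast hρ) hq'
  have hr1 : (ρ : ℝ) / q ≤ 1 := by
    rw [div_le_one hq']
    exact_mod_cast hρq
  rw [abs_le]
  constructor <;> linarith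

/-! ### 2. The congruence classes (Chinese remainder theorem) -/

/-- An odd number is coprime to its translate by `2`. -/
theorem coprime_add_two_of_odd {n : ℕ} (hn : Odd n) : Nat.Coprime n (n + 2) := by
  rw [Nat.coprime_self_add_right, Nat.coprime_comm, Nat.Prime.coprime_iff_not_dvd Nat.prime_two]
  exact Nat.two_dvd_ne_zero.mpr (Nat.odd_iff.mp hn)

/-- If `n` is odd, `e₁ ∣ n` and `e₂ ∣ n + 2`, then `e₁, e₂` are odd and coprime. -/
theorem odd_odd_coprime_of_dvd {n e₁ e₂ : ℕ} (hn : Odd n) (h₁ : e₁ ∣ n) (h₂ : e₂ ∣ n + 2) :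
    Odd e₁ ∧ Odd e₂ ∧ Nat.Coprime e₁ e₂ :=
  ⟨hn.of_dvd_nat h₁, (hn.add_even even_two).of_dvd_nat h₂,
    ((coprime_add_two_of_odd hn).coprime_dvd_left h₁).coprime_dvd_right h₂⟩

/-- If `e₁ ∣ m` and `e₂ ∣ m + 1`, then `e₁, e₂` are coprime. -/
theorem coprime_of_dvd_of_dvd_add_one {m e₁ e₂ : ℕ} (h₁ : e₁ ∣ m) (h₂ : e₂ ∣ m + 1) :
    Nat.Coprime e₁ e₂ :=
  ((Nat.coprime_self_add_right.mpr (Nat.coprime_one_right m)).coprime_dvd_left h₁).coprime_dvd_right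
    h₂

/-- Coprime moduli admit inverses: `∃ ē, e₁ē ≡ 1 (mod e₂)`. -/
theorem exists_inverse_mod {e₁ e₂ : ℕ} (hcop : Nat.Coprime e₁ e₂) : ∃ ē : ℕ, e₁ * ē ≡ 1 [MOD e₂] := by
  rcases Nat.lt_or_ge 1 e₂ with h | h
  · obtain ⟨ē, -, hē⟩ := Nat.exists_mul_mod_eq_one_of_coprime hcop h
    exact ⟨ē, by rw [Nat.ModEq, hē, Nat.mod_eq_of_lt h]⟩
  · interval_cases e₂
    · exact ⟨1, by simp [Nat.Coprime] at hcop; simp [hcop]⟩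
    · exact ⟨0, Nat.modEq_one⟩

/-- **The odd class.**  For `e₁, e₂` odd and coprime and `ē` an inverse of `e₁` modulo `e₂`:
`(n odd ∧ e₁ ∣ n ∧ e₂ ∣ n+2) ⟺ n ≡ e₁e₂ − 2e₁ē (mod 2e₁e₂)`.  The class has the fraction
`(e₁e₂ − 2e₁ē)/(2e₁e₂) = 1/2 − ē/e₂`: a Kloosterman fraction with a FIXED numerator. -/
theorem odd_and_dvd_and_dvd_add_two_iff {e₁ e₂ ē : ℕ} (ho₁ : Odd e₁) (ho₂ : Odd e₂)
    (hcop : Nat.Coprime e₁ e₂) (hē : e₁ * ē ≡ 1 [MOD e₂]) (n : ℕ) :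
    (Odd n ∧ e₁ ∣ n ∧ e₂ ∣ n + 2) ↔
      (n : ℤ) ≡ (e₁ : ℤ) * e₂ - 2 * e₁ * ē [ZMOD (2 * e₁ * e₂ : ℕ)] := by
  obtain ⟨k, hk⟩ := ho₁.mul ho₂
  have hk' : (e₁ : ℤ) * e₂ = 2 * k + 1 := by exact_mod_cast hk
  have hinv : (e₂ : ℤ) ∣ 1 - (e₁ : ℤ) * ē := by
    have := (Nat.modEq_iff_dvd.mp hē)
    push_cast at this
    exact this
  have h2e₁ : IsCoprime (2 : ℤ) (e₁ : ℤ) := by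
    have : Nat.Coprime 2 e₁ :=
      (Nat.Prime.coprime_iff_not_dvd Nat.prime_two).mpr (Nat.two_dvd_ne_zero.mpr (Nat.odd_iff.mp ho₁))
    exact_mod_cast Nat.isCoprime_iff_coprime.mpr this
  have h2e₁e₂ : IsCoprime (2 * (e₁ : ℤ)) (e₂ : ℤ) := by
    have h2 : Nat.Coprime 2 e₂ :=
      (Nat.Prime.coprime_iff_not_dvd Nat.prime_two).mpr (Nat.two_dvd_ne_zero.mpr (Nat.odd_iff.mp ho₂))
    have : Nat.Coprime (2 * e₁) e₂ := Nat.Coprime.mul_left h2 hcop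
    exact_mod_cast Nat.isCoprime_iff_coprime.mpr this
  rw [Int.modEq_iff_dvd]
  push_cast
  constructor
  · rintro ⟨⟨j, hj⟩, h₁, h₂⟩
    have hj' : (n : ℤ) = 2 * j + 1 := by exact_mod_cast hj
    have h₁' : (e₁ : ℤ) ∣ (n : ℤ) := Int.natCast_dvd_natCast.mpr h₁
    have h₂' : (e₂ : ℤ) ∣ (n : ℤ) + 2 := by exact_mod_cast Int.natCast_dvd_natCast.mpr h₂
    refine h2e₁e₂.mul_dvd (h2e₁.mul_dvd ?_ ?_) ?_
    · exact ⟨k - e₁ * ē - j, by rw [hk', hj']; ring⟩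
    · have h2ē : (e₁ : ℤ) ∣ 2 * e₁ * ē := Dvd.intro (2 * (ē : ℤ)) (by ring)
      exact ((dvd_mul_right (e₁ : ℤ) e₂).sub h2ē).sub h₁'
    · have : (e₁ : ℤ) * e₂ - 2 * e₁ * ē - n = e₂ * e₁ + 2 * (1 - e₁ * ē) - (n + 2) := by ring
      rw [this]
      exact Dvd.dvd.sub ((dvd_mul_right _ _).add (hinv.mul_left 2)) h₂'
  · intro h
    have h2 : (2 : ℤ) ∣ (e₁ : ℤ) * e₂ - 2 * e₁ * ē - n :=
      (Dvd.intro ((e₁ : ℤ) * e₂) (by ring) : (2 : ℤ) ∣ 2 * e₁ * e₂).trans h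
    have he₁ : (e₁ : ℤ) ∣ (e₁ : ℤ) * e₂ - 2 * e₁ * ē - n :=
      (Dvd.intro (2 * (e₂ : ℤ)) (by ring) : (e₁ : ℤ) ∣ 2 * e₁ * e₂).trans h
    have he₂ : (e₂ : ℤ) ∣ (e₁ : ℤ) * e₂ - 2 * e₁ * ē - n :=
      (Dvd.intro_left (2 * (e₁ : ℤ)) (by ring) : (e₂ : ℤ) ∣ 2 * e₁ * e₂).trans h
    refine ⟨?_, ?_, ?_⟩
    · obtain ⟨t, ht⟩ := h2
      have : Odd (n : ℤ) := ⟨k - e₁ * ē - t, by linarith [hk', ht]⟩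
      exact_mod_cast this
    · have : (e₁ : ℤ) ∣ (n : ℤ) := by
        have h2ē : (e₁ : ℤ) ∣ 2 * e₁ * ē := Dvd.intro (2 * (ē : ℤ)) (by ring)
        have h' := ((dvd_mul_right (e₁ : ℤ) e₂).sub h2ē).sub he₁
        simpa using h'
      exact Int.natCast_dvd_natCast.mp this
    · have h' := ((dvd_mul_left (e₂ : ℤ) e₁).add (hinv.mul_left 2)).sub he₂
      have hrw : (e₁ : ℤ) * e₂ + 2 * (1 - e₁ * ē) - (e₁ * e₂ - 2 * e₁ * ē - n)
          = ((n + 2 : ℕ) : ℤ) := by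
        push_cast
        ring
      rw [hrw] at h'
      exact Int.natCast_dvd_natCast.mp h'

/-- **The even class.**  For `e₁, e₂` coprime and `ē` an inverse of `e₁` modulo `e₂`:
`(e₁ ∣ m ∧ e₂ ∣ m+1) ⟺ m ≡ −e₁ē (mod e₁e₂)`; the fraction of the class is `−ē/e₂ (mod 1)`. -/
theorem dvd_and_dvd_add_one_iff {e₁ e₂ ē : ℕ} (hcop : Nat.Coprime e₁ e₂)
    (hē : e₁ * ē ≡ 1 [MOD e₂]) (m : ℕ) :
    (e₁ ∣ m ∧ e₂ ∣ m + 1) ↔ (m : ℤ) ≡ -((e₁ : ℤ) * ē) [ZMOD (e₁ * e₂ : ℕ)] := by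
  have hinv : (e₂ : ℤ) ∣ 1 - (e₁ : ℤ) * ē := by
    have := (Nat.modEq_iff_dvd.mp hē)
    push_cast at this
    exact this
  have hc : IsCoprime (e₁ : ℤ) (e₂ : ℤ) := Nat.isCoprime_iff_coprime.mpr hcop
  rw [Int.modEq_iff_dvd]
  push_cast
  constructor
  · rintro ⟨h₁, h₂⟩
    have h₁' : (e₁ : ℤ) ∣ (m : ℤ) := Int.natCast_dvd_natCast.mpr h₁
    have h₂' : (e₂ : ℤ) ∣ (m : ℤ) + 1 := by exact_mod_cast Int.natCast_dvd_natCast.mpr h₂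
    refine hc.mul_dvd ?_ ?_
    · exact (Dvd.intro (-(ē : ℤ)) (by ring) : (e₁ : ℤ) ∣ -((e₁ : ℤ) * ē)).sub h₁'
    · have : -((e₁ : ℤ) * ē) - m = (1 - e₁ * ē) - (m + 1) := by ring
      rw [this]
      exact hinv.sub h₂'
  · intro h
    have he₁ : (e₁ : ℤ) ∣ -((e₁ : ℤ) * ē) - m := (Dvd.intro (e₂ : ℤ) rfl : (e₁ : ℤ) ∣ e₁ * e₂).trans h
    have he₂ : (e₂ : ℤ) ∣ -((e₁ : ℤ) * ē) - m :=
      (Dvd.intro_left (e₁ : ℤ) rfl : (e₂ : ℤ) ∣ e₁ * e₂).trans h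
    refine ⟨?_, ?_⟩
    · have : (e₁ : ℤ) ∣ (m : ℤ) := by
        have h' := (Dvd.intro (-(ē : ℤ)) (by ring) : (e₁ : ℤ) ∣ -((e₁ : ℤ) * ē)).sub he₁
        simpa using h'
      exact Int.natCast_dvd_natCast.mp this
    · have h' := hinv.sub he₂
      have hrw : (1 : ℤ) - e₁ * ē - (-(e₁ * ē) - m) = ((m + 1 : ℕ) : ℤ) := by
        push_cast
        ring
      rw [hrw] at h'
      exact Int.natCast_dvd_natCast.mp h'

/-- The fraction of a representative of the odd class: `ρ/(2e₁e₂) = 1/2 − ē/e₂ + k`, `k ∈ ℤ`. -/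
theorem rep_div_eq_half_sub_of_modEq {e₁ e₂ ē ρ : ℕ} (he₁ : 0 < e₁) (he₂ : 0 < e₂)
    (hρ : (ρ : ℤ) ≡ (e₁ : ℤ) * e₂ - 2 * e₁ * ē [ZMOD (2 * e₁ * e₂ : ℕ)]) :
    ∃ k : ℤ, (ρ : ℝ) / (2 * e₁ * e₂ : ℕ) = 1 / 2 - (ē : ℝ) / e₂ + k := by
  obtain ⟨k, hk⟩ := Int.modEq_iff_dvd.mp hρ
  refine ⟨-k, ?_⟩
  have hk' : ((e₁ : ℤ) * e₂ - 2 * e₁ * ē - ρ : ℝ) = ((2 * e₁ * e₂ : ℕ) : ℝ) * k := by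
    exact_mod_cast hk
  have h₁ : (0 : ℝ) < e₁ := by exact_mod_cast he₁
  have h₂ : (0 : ℝ) < e₂ := by exact_mod_cast he₂
  push_cast at hk' ⊢
  field_simp
  linarith

/-- The fraction of a representative of the even class: `ρ/(e₁e₂) = −ē/e₂ + k`, `k ∈ ℤ`. -/
theorem rep_div_eq_neg_div_of_modEq {e₁ e₂ ē ρ : ℕ} (he₁ : 0 < e₁) (he₂ : 0 < e₂)
    (hρ : (ρ : ℤ) ≡ -((e₁ : ℤ) * ē) [ZMOD (e₁ * e₂ : ℕ)]) :
    ∃ k : ℤ, (ρ : ℝ) / (e₁ * e₂ : ℕ) = -(ē : ℝ) / e₂ + k := by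
  obtain ⟨k, hk⟩ := Int.modEq_iff_dvd.mp hρ
  refine ⟨-k, ?_⟩
  have hk' : (-((e₁ : ℤ) * ē) - ρ : ℝ) = ((e₁ * e₂ : ℕ) : ℝ) * k := by exact_mod_cast hk
  have h₁ : (0 : ℝ) < e₁ := by exact_mod_cast he₁
  have h₂ : (0 : ℝ) < e₂ := by exact_mod_cast he₂
  push_cast at hk' ⊢
  field_simp
  linarith

/-! ### 3. Step (2) of paper.md §20: the pair counts as sawtooth expressions -/

/-- The odd count is a residue-class count modulo `2e₁e₂`. -/
theorem card_odd_filter_eq_card_modEq {e₁ e₂ ē : ℕ} (ho₁ : Odd e₁) (ho₂ : Odd e₂)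
    (hcop : Nat.Coprime e₁ e₂) (hē : e₁ * ē ≡ 1 [MOD e₂]) (x : ℕ) :
    #{n ∈ (Icc 1 x).filter Odd | e₁ ∣ n ∧ e₂ ∣ n + 2}
      = #{n ∈ Icc 1 x | ((n : ℕ) : ℤ) ≡ (e₁ : ℤ) * e₂ - 2 * e₁ * ē [ZMOD (2 * e₁ * e₂ : ℕ)]} := by
  rw [filter_filter]
  exact congrArg card (filter_congr fun n _ => odd_and_dvd_and_dvd_add_two_iff ho₁ ho₂ hcop hē n)

/-- The even count is a residue-class count modulo `e₁e₂`. -/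
theorem card_filter_dvd_add_one_eq_card_modEq {e₁ e₂ ē : ℕ} (hcop : Nat.Coprime e₁ e₂)
    (hē : e₁ * ē ≡ 1 [MOD e₂]) (X : ℕ) :
    #{m ∈ Icc 1 X | e₁ ∣ m ∧ e₂ ∣ m + 1}
      = #{m ∈ Icc 1 X | ((m : ℕ) : ℤ) ≡ -((e₁ : ℤ) * ē) [ZMOD (e₁ * e₂ : ℕ)]} :=
  congrArg card (filter_congr fun m _ => dvd_and_dvd_add_one_iff hcop hē m)

/-- **Step (2) of paper.md §20, odd part.**  For `e₁, e₂` odd coprime and `e₁ē ≡ 1 (mod e₂)` there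
is `ρ ∈ (0, 2e₁e₂]` with `ρ/(2e₁e₂) ≡ 1/2 − ē/e₂ (mod 1)` such that for every `x`
`#{n ≤ x odd : e₁ ∣ n, e₂ ∣ n+2} = x/Q − (ρ/Q − 1/2) − ψ((x − ρ)/Q)`, `Q = 2e₁e₂`, `ψ(t) = {t} − 1/2`. -/
theorem odd_twin_count_sawtooth {e₁ e₂ ē : ℕ} (ho₁ : Odd e₁) (ho₂ : Odd e₂)
    (hcop : Nat.Coprime e₁ e₂) (hē : e₁ * ē ≡ 1 [MOD e₂]) :
    ∃ ρ : ℕ, 0 < ρ ∧ ρ ≤ 2 * e₁ * e₂ ∧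
      (∃ k : ℤ, (ρ : ℝ) / (2 * e₁ * e₂ : ℕ) = 1 / 2 - (ē : ℝ) / e₂ + k) ∧
      ∀ x : ℕ, (#{n ∈ (Icc 1 x).filter Odd | e₁ ∣ n ∧ e₂ ∣ n + 2} : ℝ)
        = x / (2 * e₁ * e₂ : ℕ) - ((ρ : ℝ) / (2 * e₁ * e₂ : ℕ) - 1 / 2)
          - (Int.fract (((x : ℝ) - ρ) / (2 * e₁ * e₂ : ℕ)) - 1 / 2) := by
  have he₁ : 0 < e₁ := ho₁.pos
  have he₂ : 0 < e₂ := ho₂.pos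
  have hQ : 0 < 2 * e₁ * e₂ := by positivity
  obtain ⟨ρ, hρ, hρQ, hρc⟩ := exists_rep_Ioc hQ ((e₁ : ℤ) * e₂ - 2 * e₁ * ē)
  refine ⟨ρ, hρ, hρQ, rep_div_eq_half_sub_of_modEq he₁ he₂ hρc, fun x => ?_⟩
  rw [card_odd_filter_eq_card_modEq ho₁ ho₂ hcop hē x,
    card_Icc_filter_modEq_eq_sawtooth hQ hρ hρQ hρc x]

/-- **Step (2) of paper.md §20, even part.**  For `e₁, e₂ ≥ 1` coprime and `e₁ē ≡ 1 (mod e₂)` there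
is `ρ ∈ (0, e₁e₂]` with `ρ/(e₁e₂) ≡ −ē/e₂ (mod 1)` such that for every `X`
`#{m ≤ X : e₁ ∣ m, e₂ ∣ m+1} = X/Q − (ρ/Q − 1/2) − ψ((X − ρ)/Q)`, `Q = e₁e₂`. -/
theorem even_twin_count_sawtooth {e₁ e₂ ē : ℕ} (he₁ : 0 < e₁) (he₂ : 0 < e₂)
    (hcop : Nat.Coprime e₁ e₂) (hē : e₁ * ē ≡ 1 [MOD e₂]) :
    ∃ ρ : ℕ, 0 < ρ ∧ ρ ≤ e₁ * e₂ ∧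
      (∃ k : ℤ, (ρ : ℝ) / (e₁ * e₂ : ℕ) = -(ē : ℝ) / e₂ + k) ∧
      ∀ X : ℕ, (#{m ∈ Icc 1 X | e₁ ∣ m ∧ e₂ ∣ m + 1} : ℝ)
        = X / (e₁ * e₂ : ℕ) - ((ρ : ℝ) / (e₁ * e₂ : ℕ) - 1 / 2)
          - (Int.fract (((X : ℝ) - ρ) / (e₁ * e₂ : ℕ)) - 1 / 2) := by
  have hQ : 0 < e₁ * e₂ := by positivity
  obtain ⟨ρ, hρ, hρQ, hρc⟩ := exists_rep_Ioc hQ (-((e₁ : ℤ) * ē))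
  refine ⟨ρ, hρ, hρQ, rep_div_eq_neg_div_of_modEq he₁ he₂ hρc, fun X => ?_⟩
  rw [card_filter_dvd_add_one_eq_card_modEq hcop hē X,
    card_Icc_filter_modEq_eq_sawtooth hQ hρ hρQ hρc X]

end Summit.Parity.BatemanHorn.Theorems
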